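import Literature.Probability.Percolation.TriLowestCrossingSwitch
import HarnessLib

/-!
# Successive lowest crossings of a lattice quad: forcing, anchoring and the rerouting lemma

Topic `Literature/Probability/Percolation`; family `crit-perc`, statement **crit-perc.S16**
(`Literature.Probability.Percolation.triTheta_exponent`). Combinatorial groundwork for Kesten's
**arm-separation lemma** in the form of P. Nolin, *Near-critical percolation in two dimensions*,
EJP 13 (2008), §4.4, Lemma 15 [arXiv 0711.4948: Lemma 14] ("In a U-shaped region, any set of
disjoint crossings can be made well-separated with high probability"), whose proof rests on the
successive lowest crossings:

> "Consider now the following construction: take `c₁` the lowest (ie closest to the bottom side)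
> monochromatic crossing (which can be either black or white), then `c₂` the lowest monochromatic
> crossing disjoint from `c₁`, and so on. […] In order to get some independence and be able to
> apply the previous construction around the extremities of the crossings, we condition on the
> successive crossings. […] The event `E_u` is independent from the status of the sites above
> `c̃_u`. […] If we take `c'₁` for instance, it has to cross at least one of the `c_v` (by
> maximality of `𝒞`). Let us call `c_{v₁}` the lowest one: still by maximality, `c'₁` cannot go
> below it. Take the piece of `c'₁` between its extremity `z'₁` and its last intersection `a₁`
> with `c_{v₁}`, and replace it with the corresponding piece of `c_{v₁}`."

Discrete rendering, for an abstract lattice quad `Q` (`TriQuad`, `TriLowestCrossingSwitch.lean`).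
One *stage* of the construction, relative to a finite set `P` of already examined sites (the
sites at or below the crossings found so far), explores **both** colours: the open crossings
avoiding `P` are the open crossings of the configuration `ω \ P` (`P` forced closed), the lowest of
which lies in the explored set `Q.explored (ω \ P)`; symmetrically for the closed crossings, with
`ωᶜ \ P`. The stage examines `Q.stage P ω = P ∪ Q.explored (ω \ P) ∪ Q.explored (ωᶜ \ P)`.

* `TriQuad.Anchored Q P` — every site of `P` is joined to the bottom part inside `P` (invariant
  of the construction: `anchored_stage`); then `P` lies in the closed cluster of the bottom part
  of `ω \ P` (`subset_botCluster_sdiff`).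
* `TriQuad.isStoppingSet_stage` — if `P = P(ω)` is a stopping set contained in the stage, the
  stage is a stopping set ("the event that `P'` takes a particular value is independent of the
  states of the other sites").
* `TriQuad.reroute` — **the rerouting lemma** (Nolin's replacement of the tip of `c'₁` by the tip
  of `c_{v₁}`, in the form needed for arms): if an open crossing `α` avoids `P` but meets the
  stage set, then *every* open crossing `γ` inside `Q.explored (ω \ P)` (a lowest open crossing
  avoiding `P`) is joined to `α` by an open path avoiding `P`. The proof uses only the ordering
  dichotomy `TriQuad.low_dichotomy` and the structure of explored sets — no Jordan curve theorem:
  if `α` meets `Q.explored (ω \ P)` the two tight supports cannot be disjoint (each would have to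
  lie above the other); if `α` meets `Q.explored (ωᶜ \ P)` only, `α` lies in the open cluster of
  the bottom part of `ω ∪ P`, and the last exit of a joining path from `Q.explored (ω \ P)` starts
  at an open frontier site, from which an open path off `P` leads to `α`; the first case then
  applies to `α` enlarged by that path.
* `TriQuad.stages` — the iteration `N₀ = ∅`, `N_{u+1} = Q.stage N_u ω`; monotone, anchored, a
  stopping set at every step (`isStoppingSet_stages`), strictly growing while a crossing of either
  colour avoids it (`ssubset_stages_succ`), and **maximal**: every open crossing of `ω` meets some
  `N_{u+1} \ N_u` while avoiding `N_u` (`exists_touch_stages`), where the rerouting lemma applies.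

## References

* P. Nolin, Near-critical percolation in two dimensions, *Electron. J. Probab.* 13 (2008), §4.4,
  Lemma 15 and its proof [arXiv 0711.4948: Lemma 14] [Nolin2008].
* H. Kesten, Scaling relations for 2D-percolation, *Comm. Math. Phys.* 109 (1987), Lemma 2
  (separation of arms) [KestenScalingCMP1987].
* B. Bollobás, O. Riordan, *Percolation*, CUP (2006), Ch. 7, proof of Lemma 6, p. 175 (stopping
  sets) [BollobasRiordan2006].

## Mathlib / tree

Tree: `TriQuad`, `TriQuad.explored`, `TriQuad.botCluster`, `TriQuad.isStoppingSet_explored`,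
`TriQuad.exists_lr_subset_explored`, `TriQuad.explored_subset_low`, `TriQuad.low_dichotomy`,
`TriQuad.LRPath` (`TriLowestCrossingSwitch.lean`), `IsStoppingSet` (`ColourSwitching.lean`),
`PathIn.exists_support` (`TriRSWChaining.lean`), `PathIn.last_exit` (`SitePaths.lean`).
-/

noncomputable section

open Set

namespace Literature.Probability.Percolation

open LatticeModels

namespace TriQuad

variable {Q : TriQuad}

/-! ### Anchored sets and forcing -/

variable (Q) in
/-- **An anchored set of examined sites**: `P ⊆ U`, and every site of `P` is joined to the bottom
part by a `𝕋`-path inside `P` (as are the explored sets of the successive lowest crossings: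
bottom part, clusters of the bottom part and their neighbours). [cite: Nolin2008, §4.4, proof of Lemma 15 (arXiv 0711.4948: Lemma 14): conditioning on the successive crossings] -/
def Anchored (P : Finset (Site 2)) : Prop :=
  P ⊆ Q.U ∧ ∀ v ∈ P, ∃ b ∈ Q.B, PathIn triGraph (↑P) b v

/-- The empty set is anchored. [folklore] -/
theorem anchored_empty : Q.Anchored ∅ := ⟨Finset.empty_subset _, fun _ hv => absurd hv (Finset.notMem_empty _)⟩

/-- **Forcing an anchored set closed puts it in the closed cluster of the bottom part**: every
site of `P` belongs to `Q.botCluster (ω \ P)`. [folklore] -/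
theorem subset_botCluster_sdiff {P : Finset (Site 2)} (hP : Q.Anchored P) (ω : Set (Site 2)) :
    (↑P : Set (Site 2)) ⊆ Q.botCluster (ω \ ↑P) := by
  intro v hv
  obtain ⟨b, hb, hp⟩ := hP.2 v (Finset.mem_coe.1 hv)
  exact ⟨b, hb, hp.mono fun z hz => ⟨Finset.mem_coe.2 (hP.1 (Finset.mem_coe.1 hz)), fun h => h.2 hz⟩⟩

/-- Hence an anchored `P` lies in the explored set of `ω \ P`. [folklore] -/
theorem subset_explored_sdiff {P : Finset (Site 2)} (hP : Q.Anchored P) (ω : Set (Site 2)) :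
    P ⊆ Q.explored (ω \ ↑P) := fun _ hv =>
  Finset.mem_coe.1 (botCluster_subset_explored (subset_botCluster_sdiff hP ω (Finset.mem_coe.2 hv)))

/-- The explored set of any configuration is anchored. [folklore] -/
theorem anchored_explored (ξ : Set (Site 2)) : Q.Anchored (Q.explored ξ) := by
  -- closed paths from the bottom part run inside the closed cluster, hence inside the explored set
  have hreach : ∀ {b u : Site 2}, b ∈ Q.B → PathIn triGraph (↑Q.U ∩ ξᶜ) b u →
      PathIn triGraph (↑(Q.explored ξ)) b u := by
    intro b u hb hp
    obtain ⟨hbA, hp⟩ := hp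
    induction hp with
    | refl => exact PathIn.refl (bot_subset_explored ξ hb)
    | @tail c d hbc hcd ih =>
      exact ih.tail hcd.1 (botCluster_subset_explored ⟨b, hb, ⟨hbA, hbc.tail hcd⟩⟩)
  refine ⟨explored_subset ξ, fun v hv => ?_⟩
  obtain ⟨hvU, hv | ⟨u, hu, huv⟩⟩ := mem_explored.1 hv
  · exact ⟨v, hv, PathIn.refl (bot_subset_explored ξ hv)⟩
  · obtain ⟨b, hb, hp⟩ := hu
    have hp' := hreach hb hp
    rcases huv with rfl | huv
    · exact ⟨b, hb, hp'⟩
    · exact ⟨b, hb, hp'.tail huv (Finset.mem_coe.2 hv)⟩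

/-- The union of two anchored sets is anchored. [folklore] -/
theorem Anchored.union {P P' : Finset (Site 2)} (hP : Q.Anchored P) (hP' : Q.Anchored P') :
    Q.Anchored (P ∪ P') := by
  classical
  refine ⟨Finset.union_subset hP.1 hP'.1, fun v hv => ?_⟩
  rcases Finset.mem_union.1 hv with hv | hv
  · obtain ⟨b, hb, hp⟩ := hP.2 v hv
    exact ⟨b, hb, hp.mono fun z hz => by rw [Finset.coe_union]; exact Or.inl hz⟩
  · obtain ⟨b, hb, hp⟩ := hP'.2 v hv
    exact ⟨b, hb, hp.mono fun z hz => by rw [Finset.coe_union]; exact Or.inr hz⟩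

/-! ### One stage: exploring both colours above the examined set -/

open Classical in
variable (Q) in
/-- **One stage of the successive-lowest-crossings construction**: the examined set `P`, the
explored set of the lowest open crossing avoiding `P` (explored in `ω \ P`, i.e. with `P` forced
closed) and the explored set of the lowest closed crossing avoiding `P` (explored in `ωᶜ \ P`). [cite: Nolin2008, §4.4, proof of Lemma 15 (arXiv 0711.4948: Lemma 14)] -/
def stage (P : Finset (Site 2)) (ω : Set (Site 2)) : Finset (Site 2) :=
  P ∪ (Q.explored (ω \ ↑P) ∪ Q.explored (ωᶜ \ ↑P))

/-- Membership in a stage. [folklore] -/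
theorem mem_stage {P : Finset (Site 2)} {ω : Set (Site 2)} {v : Site 2} :
    v ∈ Q.stage P ω ↔ v ∈ P ∨ v ∈ Q.explored (ω \ ↑P) ∨ v ∈ Q.explored (ωᶜ \ ↑P) := by
  classical
  rw [stage, Finset.mem_union, Finset.mem_union]

/-- The examined set grows. [folklore] -/
theorem subset_stage (P : Finset (Site 2)) (ω : Set (Site 2)) : P ⊆ Q.stage P ω :=
  fun _ hv => mem_stage.2 (Or.inl hv)

/-- The stage is symmetric under colour exchange. [folklore] -/
theorem stage_compl (P : Finset (Site 2)) (ω : Set (Site 2)) : Q.stage P ωᶜ = Q.stage P ω := by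
  ext v; rw [mem_stage, mem_stage, compl_compl]; tauto

/-- A stage of an anchored set is anchored. [folklore] -/
theorem anchored_stage {P : Finset (Site 2)} (hP : Q.Anchored P) (ω : Set (Site 2)) :
    Q.Anchored (Q.stage P ω) := by
  classical
  unfold stage
  exact hP.union ((anchored_explored _).union (anchored_explored _))

/-- The stage lies in the domain. [folklore] -/
theorem stage_subset {P : Finset (Site 2)} (hP : Q.Anchored P) (ω : Set (Site 2)) : Q.stage P ω ⊆ Q.U :=
  (anchored_stage hP ω).1

/-- **The stage is a stopping set** when `P = P(ω)` is one with `P(ω) ⊆ Q.stage (P ω) ω`: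
agreement on the stage gives agreement on `P`, hence the same `P`, hence the same forced
configurations on their explored sets, hence the same explored sets. [cite: BollobasRiordan2006, Ch. 7 proof of Lemma 6 p. 175] -/
theorem isStoppingSet_stage {P : Set (Site 2) → Finset (Site 2)} (hP : IsStoppingSet P) :
    IsStoppingSet fun ω => Q.stage (P ω) ω := by
  intro ω ω' h
  have hPP : P ω' = P ω := hP ω ω' fun v hv => h v (subset_stage _ _ hv)
  simp only [hPP]
  have h1 : Q.explored (ω' \ ↑(P ω)) = Q.explored (ω \ ↑(P ω)) :=
    Q.isStoppingSet_explored _ _ fun v hv => by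
      have := h v (mem_stage.2 (Or.inr (Or.inl hv)))
      simp only [mem_sdiff, this]
  have h2 : Q.explored (ω'ᶜ \ ↑(P ω)) = Q.explored (ωᶜ \ ↑(P ω)) :=
    Q.isStoppingSet_explored _ _ fun v hv => by
      have := h v (mem_stage.2 (Or.inr (Or.inr hv)))
      simp only [mem_sdiff, mem_compl_iff, this]
  unfold stage
  rw [h1, h2]


/-! ### The rerouting lemma -/

/-- Sites of the explored set are joined to the bottom part off any set of sites of the forced-open
colour (the step behind both alternatives of the rerouting lemma). [folklore] -/
theorem joined_bot_of_mem_explored {ξ S : Set (Site 2)} (hS : S ⊆ ↑Q.U ∩ ξ) {v : Site 2}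
    (hv : v ∈ Q.explored ξ) (hvS : v ∉ S) : ∃ b ∈ Q.B, PathIn triGraph (↑Q.U \ S) b v := by
  rcases explored_subset_low hS hv with h | h
  · exact absurd h hvS
  · exact h

/-- **Two crossings, one inside the explored set, the other touching it, must meet** (the core of
the rerouting lemma): if `Sγ ⊆ explored ξ` and `Sα` are tight supports of `L–R` crossings by
sites of `ξ`, and `Sα` meets the explored set, then `Sγ ∩ Sα ≠ ∅` — by `low_dichotomy`, each
would otherwise have to lie above the other. [cite: Nolin2008, §4.4, proof of Lemma 15 ("c'₁ cannot go below it"; arXiv 0711.4948: Lemma 14)] -/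
theorem inter_nonempty_of_touch {ξ Sγ Sα : Set (Site 2)} (hSγ : Sγ ⊆ ↑Q.U ∩ ξ) (hSα : Sα ⊆ ↑Q.U ∩ ξ)
    (hγE : Sγ ⊆ ↑(Q.explored ξ))
    {xγ yγ : Site 2} (hxγ : xγ ∈ Q.L) (hyγ : yγ ∈ Q.R) (hpγ : PathIn triGraph Sγ xγ yγ)
    (hallγ : ∀ z ∈ Sγ, PathIn triGraph Sγ xγ z)
    {xα yα : Site 2} (hxα : xα ∈ Q.L) (hyα : yα ∈ Q.R) (hpα : PathIn triGraph Sα xα yα)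
    (hallα : ∀ z ∈ Sα, PathIn triGraph Sα xα z)
    {w : Site 2} (hwα : w ∈ Sα) (hwE : w ∈ Q.explored ξ) : (Sγ ∩ Sα).Nonempty := by
  by_contra hne
  rw [Set.not_nonempty_iff_eq_empty] at hne
  have hdisj : Disjoint Sγ Sα := Set.disjoint_iff_inter_eq_empty.2 hne
  rcases low_dichotomy (fun z hz => (hSγ hz).1) (fun z hz => (hSα hz).1) hdisj hxγ hyγ hpγ hallγ
    hxα hyα hpα hallα with h | h
  · -- `Sα` above `Sγ`: impossible at the touching site `w`
    exact h w hwα (joined_bot_of_mem_explored hSγ hwE fun hwγ => Set.disjoint_left.1 hdisj hwγ hwα)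
  · -- `Sγ` above `Sα`: impossible at any site of `Sγ`
    have hx : xγ ∈ Sγ := hpγ.left_mem
    exact h xγ hx (joined_bot_of_mem_explored hSα (Finset.mem_coe.1 (hγE hx))
      fun hxα' => Set.disjoint_left.1 hdisj hx hxα')

/-- **The rerouting lemma** (Nolin: replace the tip of `c'₁` by the tip of the lowest canonical
crossing it meets). Let `P` be anchored, `γ` an open crossing avoiding `P` inside the explored set
`Q.explored (ω \ P)` (a lowest open crossing avoiding `P`), and `α` an open crossing avoiding `P`
which meets the stage `Q.stage P ω`. Then an open path of `U` avoiding `P` joins a site of `γ` to a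
site of `α` (given as tight supports `Sγ`, `Sα`). [cite: Nolin2008, §4.4, proof of Lemma 15 (rerouting; arXiv 0711.4948: Lemma 14)] -/
theorem reroute {P : Finset (Site 2)} (hP : Q.Anchored P) {ω : Set (Site 2)}
    {Sγ : Set (Site 2)} (hSγ : Sγ ⊆ ↑Q.U ∩ (ω \ ↑P)) (hγE : Sγ ⊆ ↑(Q.explored (ω \ ↑P)))
    {xγ yγ : Site 2} (hxγ : xγ ∈ Q.L) (hyγ : yγ ∈ Q.R) (hpγ : PathIn triGraph Sγ xγ yγ)
    (hallγ : ∀ z ∈ Sγ, PathIn triGraph Sγ xγ z)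
    {Sα : Set (Site 2)} (hSα : Sα ⊆ ↑Q.U ∩ (ω \ ↑P))
    {xα yα : Site 2} (hxα : xα ∈ Q.L) (hyα : yα ∈ Q.R) (hpα : PathIn triGraph Sα xα yα)
    (hallα : ∀ z ∈ Sα, PathIn triGraph Sα xα z)
    (htouch : ∃ w ∈ Sα, w ∈ Q.stage P ω) :
    ∃ z ∈ Sγ, ∃ z' ∈ Sα, PathIn triGraph (↑Q.U ∩ (ω \ ↑P)) z z' := by
  set ξ : Set (Site 2) := ω \ ↑P with hξ
  obtain ⟨w, hwα, hw⟩ := htouch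
  rcases mem_stage.1 hw with hwP | hwE | hwE'
  · exact absurd hwP (hSα hwα).2.2
  · -- `α` meets the explored set of `ω \ P`: the supports meet
    obtain ⟨z, hzγ, hzα⟩ := inter_nonempty_of_touch hSγ hSα hγE hxγ hyγ hpγ hallγ hxα hyα hpα hallα hwα hwE
    exact ⟨z, hzγ, z, hzα, PathIn.refl (hSα hzα)⟩
  · -- `α` meets the explored set of `ωᶜ \ P` only
    by_cases hwE2 : w ∈ Q.explored (ω \ ↑P)
    · obtain ⟨z, hzγ, hzα⟩ := inter_nonempty_of_touch hSγ hSα hγE hxγ hyγ hpγ hallγ hxα hyα hpα hallα hwα hwE2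
      exact ⟨z, hzγ, z, hzα, PathIn.refl (hSα hzα)⟩
    -- `w` lies in the open cluster of the bottom part of `ω ∪ P`
    have hwω : w ∈ ω ∧ w ∉ (↑P : Set (Site 2)) := ⟨(hSα hwα).2.1, (hSα hwα).2.2⟩
    obtain ⟨hwU, hwB | ⟨k, hk, hkw⟩⟩ := mem_explored.1 hwE'
    · exact absurd (Finset.mem_coe.1 (bot_subset_explored (ω \ ↑P) hwB)) hwE2
    have hwK : w ∈ Q.botCluster (ωᶜ \ ↑P) := by
      rcases hkw with rfl | hkw
      · exact hk
      · obtain ⟨b, hb, hp⟩ := hk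
        exact ⟨b, hb, hp.tail hkw ⟨Finset.mem_coe.2 hwU, fun h => h.1 hwω.1⟩⟩
    obtain ⟨b, hb, hbw⟩ := hwK
    -- last exit of the joining path from the explored set `W` of `ω \ P`
    set W : Set (Site 2) := ↑(Q.explored (ω \ ↑P)) with hW
    have hbW : b ∈ W := bot_subset_explored _ hb
    have hwW : w ∉ W := fun h => hwE2 (Finset.mem_coe.1 h)
    obtain ⟨m, m', hmW, hmA, hm'W, hmm', htail⟩ := hbw.last_exit hbW hwW
    -- `m` is an open frontier site of `ω \ P`, and the tail runs through open sites off `P`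
    have hPW : (↑P : Set (Site 2)) ⊆ W := fun v hv => subset_explored_sdiff hP ω (Finset.mem_coe.1 hv)
    have hmK : m ∉ Q.botCluster (ω \ ↑P) := fun hmK =>
      hm'W (Finset.mem_coe.2 (mem_explored_of_adj hmK hmm' (Finset.mem_coe.1 htail.left_mem.1.1)))
    have hmopen : m ∈ ω \ ↑P := by
      have hmU : m ∈ Q.U := Finset.mem_coe.1 hmA.1
      by_contra hmc
      obtain ⟨-, hmB | ⟨u, hu, huv⟩⟩ := mem_explored.1 (Finset.mem_coe.1 hmW)
      · exact hmK ⟨m, hmB, PathIn.refl ⟨Finset.mem_coe.2 hmU, hmc⟩⟩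
      · rcases huv with rfl | huv
        · exact hmK hu
        · obtain ⟨b', hb', hp'⟩ := hu
          exact hmK ⟨b', hb', hp'.tail huv ⟨Finset.mem_coe.2 hmU, hmc⟩⟩
    have htail' : PathIn triGraph (↑Q.U ∩ (ω \ ↑P)) m' w := by
      refine htail.mono fun z hz => ⟨hz.1.1, ?_, fun hzP => hz.2 (hPW hzP)⟩
      have := hz.1.2
      simp only [mem_compl_iff, mem_sdiff, not_and, not_not] at this
      by_contra hzω
      exact hz.2 (hPW (this hzω))
    have hpath : PathIn triGraph (↑Q.U ∩ (ω \ ↑P)) m w :=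
      ((PathIn.refl (show m ∈ (↑Q.U : Set (Site 2)) ∩ (ω \ ↑P) from ⟨hmA.1, hmopen⟩)).tail hmm'
        htail'.left_mem).trans htail'
    -- enlarge `α` by the tight support of this path and apply the first case
    obtain ⟨T, hT, hTp, hTall⟩ := hpath.exists_support
    set S' : Set (Site 2) := Sα ∪ T with hS'
    have hS'U : S' ⊆ ↑Q.U ∩ (ω \ ↑P) := union_subset hSα hT
    have hall' : ∀ z ∈ S', PathIn triGraph S' xα z := by
      rintro z (hz | hz)
      · exact (hallα z hz).mono subset_union_left
      · exact (((hallα w hwα).mono subset_union_left).trans ((hTp.symm.trans (hTall z hz)).mono subset_union_right))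
    obtain ⟨z, hzγ, hzS'⟩ := inter_nonempty_of_touch hSγ hS'U hγE hxγ hyγ hpγ hallγ hxα hyα
      (hpα.mono subset_union_left) hall' (Or.inr hTp.left_mem) (Finset.mem_coe.1 hmW)
    rcases hzS' with hz | hz
    · exact ⟨z, hzγ, z, hz, PathIn.refl (hSα hz)⟩
    · exact ⟨z, hzγ, w, hwα, ((hTall z hz).symm.trans hTp).mono hT⟩

/-! ### The iteration -/

/-- **The successive lowest crossings**: `N₀ = ∅`, `N_{u+1} = stage N_u` (both colours at each
stage). [cite: Nolin2008, §4.4, proof of Lemma 15 (arXiv 0711.4948: Lemma 14)] -/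
def stages (Q : TriQuad) (ω : Set (Site 2)) : ℕ → Finset (Site 2)
  | 0 => ∅
  | u + 1 => Q.stage (stages Q ω u) ω

/-- `N₀ = ∅`. [folklore] -/
@[simp] theorem stages_zero (ω : Set (Site 2)) : Q.stages ω 0 = ∅ := rfl

/-- `N_{u+1} = stage N_u`. [folklore] -/
theorem stages_succ (ω : Set (Site 2)) (u : ℕ) : Q.stages ω (u + 1) = Q.stage (Q.stages ω u) ω := rfl

/-- The examined sets are anchored. [folklore] -/
theorem anchored_stages (ω : Set (Site 2)) : ∀ u, Q.Anchored (Q.stages ω u)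
  | 0 => anchored_empty
  | u + 1 => anchored_stage (anchored_stages ω u) ω

/-- The examined sets lie in the domain. [folklore] -/
theorem stages_subset (ω : Set (Site 2)) (u : ℕ) : Q.stages ω u ⊆ Q.U := (anchored_stages ω u).1

/-- The examined sets grow. [folklore] -/
theorem stages_mono (ω : Set (Site 2)) : Monotone (Q.stages ω) :=
  monotone_nat_of_le_succ fun u => by rw [stages_succ]; exact subset_stage _ _

/-- The iteration is symmetric under colour exchange. [folklore] -/
theorem stages_compl (ω : Set (Site 2)) : ∀ u, Q.stages ωᶜ u = Q.stages ω u
  | 0 => rfl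
  | u + 1 => by rw [stages_succ, stages_succ, stages_compl ω u, stage_compl]

variable (Q) in
/-- **Each examined set is a stopping set** ("we condition on the successive crossings"). [cite: Nolin2008, §4.4, proof of Lemma 15 (arXiv 0711.4948: Lemma 14)] [cite: BollobasRiordan2006, Ch. 7 proof of Lemma 6 p. 175] -/
theorem isStoppingSet_stages : ∀ u, IsStoppingSet fun ω => Q.stages ω u
  | 0 => fun _ _ _ => rfl
  | u + 1 => isStoppingSet_stage (isStoppingSet_stages u)

/-- **While a crossing of either colour avoids the examined set, the next stage is strictly
larger** (a new crossing, avoiding the examined set, is explored). [folklore] -/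
theorem ssubset_stages_succ {ω : Set (Site 2)} {u : ℕ}
    (h : Q.LRPath (ω \ ↑(Q.stages ω u)) ∨ Q.LRPath (ωᶜ \ ↑(Q.stages ω u))) :
    Q.stages ω u ⊂ Q.stages ω (u + 1) := by
  rw [Finset.ssubset_iff_subset_ne]
  refine ⟨stages_mono ω (Nat.le_succ u), fun heq => ?_⟩
  have key : ∀ ξ : Set (Site 2), Q.LRPath (ξ \ ↑(Q.stages ω u)) →
      Q.explored (ξ \ ↑(Q.stages ω u)) ⊆ Q.stages ω (u + 1) → False := by
    intro ξ hξ hsub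
    obtain ⟨x, -, y, -, hp⟩ := exists_lr_subset_explored hξ
    have hx := hp.left_mem
    exact hx.2.1.2 (by rw [heq]; exact hsub (Finset.mem_coe.1 hx.2.2))
  rcases h with h | h
  · exact key ω h fun v hv => by rw [stages_succ]; exact mem_stage.2 (Or.inr (Or.inl hv))
  · exact key ωᶜ h fun v hv => by rw [stages_succ]; exact mem_stage.2 (Or.inr (Or.inr hv))

/-- **The construction terminates**: after `|U| + 1` stages no crossing of either colour avoids the
examined set. [folklore] -/
theorem not_LRPath_stages (ω : Set (Site 2)) :
    ∃ t ≤ Q.U.card + 1, ¬ Q.LRPath (ω \ ↑(Q.stages ω t)) ∧ ¬ Q.LRPath (ωᶜ \ ↑(Q.stages ω t)) := by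
  by_contra hcon
  push Not at hcon
  have hgrow : ∀ t ≤ Q.U.card + 1, t ≤ (Q.stages ω t).card := by
    intro t ht
    induction t with
    | zero => simp
    | succ t ih =>
      have h1 := ih (Nat.le_of_succ_le ht)
      have hor : Q.LRPath (ω \ ↑(Q.stages ω t)) ∨ Q.LRPath (ωᶜ \ ↑(Q.stages ω t)) := by
        by_cases h' : Q.LRPath (ω \ ↑(Q.stages ω t))
        · exact Or.inl h'
        · exact Or.inr (hcon t (Nat.le_of_succ_le ht) h')
      have h2 := Finset.card_lt_card (ssubset_stages_succ hor)
      omega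
  have h3 := hgrow (Q.U.card + 1) le_rfl
  have h4 := Finset.card_le_card (stages_subset (Q := Q) ω (Q.U.card + 1))
  omega

/-- **Maximality**: every open crossing of `ω` (given with its tight support) avoids some examined
set `N_u` and meets the next one `N_{u+1}` — where the rerouting lemma applies with
`P = N_u`. [cite: Nolin2008, §4.4, proof of Lemma 15 ("by maximality of 𝒞"; arXiv 0711.4948: Lemma 14)] -/
theorem exists_touch_stages {ω S : Set (Site 2)} (hS : S ⊆ ↑Q.U ∩ ω) {x y : Site 2} (hx : x ∈ Q.L)
    (hy : y ∈ Q.R) (hp : PathIn triGraph S x y) :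
    ∃ u, Disjoint S ↑(Q.stages ω u) ∧ ∃ w ∈ S, w ∈ Q.stages ω (u + 1) := by
  classical
  obtain ⟨t, -, ht, -⟩ := not_LRPath_stages (Q := Q) ω
  -- `S` meets `N_t`
  have hmeet : ∃ w ∈ S, w ∈ Q.stages ω t := by
    by_contra hcon
    push Not at hcon
    exact ht ⟨x, hx, y, hy, hp.mono fun z hz => ⟨(hS hz).1, (hS hz).2, fun h => hcon z hz (Finset.mem_coe.1 h)⟩⟩
  -- the first such stage
  have hex : ∃ u, ∃ w ∈ S, w ∈ Q.stages ω u := ⟨t, hmeet⟩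
  have hu₀spec : ∃ w ∈ S, w ∈ Q.stages ω (Nat.find hex) := Nat.find_spec hex
  have hu₀pos : Nat.find hex ≠ 0 := by
    intro h0
    obtain ⟨w, -, hw⟩ := hu₀spec
    rw [h0, stages_zero] at hw
    exact Finset.notMem_empty w hw
  obtain ⟨u, hu⟩ : ∃ u, Nat.find hex = u + 1 := Nat.exists_eq_succ_of_ne_zero hu₀pos
  rw [hu] at hu₀spec
  refine ⟨u, Set.disjoint_left.2 fun z hz hz' => ?_, hu₀spec⟩
  have hmin := Nat.find_min hex (show u < Nat.find hex from by rw [hu]; exact Nat.lt_succ_self u)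
  exact hmin ⟨z, hz, Finset.mem_coe.1 hz'⟩

/-- **Rerouting an arbitrary open crossing into a canonical one.** For every open crossing `α` of
`ω` (tight support `Sα`) there are a stage `u`, with `α` avoiding `N_u`, and an open crossing `γ`
avoiding `N_u` inside the explored set `Q.explored (ω \ N_u)` — a lowest open crossing of stage
`u + 1` — joined to `α` by an open path avoiding `N_u`; moreover every such `γ` works. [cite: Nolin2008, §4.4, proof of Lemma 15 (arXiv 0711.4948: Lemma 14)] -/
theorem exists_stage_reroute {ω Sα : Set (Site 2)} (hSα : Sα ⊆ ↑Q.U ∩ ω) {xα yα : Site 2}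
    (hxα : xα ∈ Q.L) (hyα : yα ∈ Q.R) (hpα : PathIn triGraph Sα xα yα)
    (hallα : ∀ z ∈ Sα, PathIn triGraph Sα xα z) :
    ∃ u, Disjoint Sα ↑(Q.stages ω u) ∧ Q.LRPath (ω \ ↑(Q.stages ω u)) ∧
      ∀ {Sγ : Set (Site 2)}, Sγ ⊆ ↑Q.U ∩ (ω \ ↑(Q.stages ω u)) →
        Sγ ⊆ ↑(Q.explored (ω \ ↑(Q.stages ω u))) →
        ∀ {xγ yγ : Site 2}, xγ ∈ Q.L → yγ ∈ Q.R → PathIn triGraph Sγ xγ yγ →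
          (∀ z ∈ Sγ, PathIn triGraph Sγ xγ z) →
            ∃ z ∈ Sγ, ∃ z' ∈ Sα, PathIn triGraph (↑Q.U ∩ (ω \ ↑(Q.stages ω u))) z z' := by
  obtain ⟨u, hdisj, w, hwα, hw⟩ := exists_touch_stages hSα hxα hyα hpα
  have hSα' : Sα ⊆ ↑Q.U ∩ (ω \ ↑(Q.stages ω u)) := fun z hz =>
    ⟨(hSα hz).1, (hSα hz).2, fun h => Set.disjoint_left.1 hdisj hz h⟩
  refine ⟨u, hdisj, ⟨xα, hxα, yα, hyα, hpα.mono hSα'⟩, ?_⟩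
  intro Sγ hSγ hγE xγ yγ hxγ hyγ hpγ hallγ
  rw [stages_succ] at hw
  exact reroute (anchored_stages ω u) hSγ hγE hxγ hyγ hpγ hallγ hSα' hxα hyα hpα hallα ⟨w, hwα, hw⟩

end TriQuad

end Literature.Probability.Percolation
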